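import Mathlib
import Summits.Schanuel.Schanuel.Theses.RigidCore
import Literature.NumberTheory.Transcendental.ExpVarieties

/-!
# FCS⁺ — the research-level core of stub S7b `stub_corankGeTwo_noFullLine`, ELABORATED
# (crux stmt-Schanuel-0969 `RigidCore.MinimalCounterexampleInAcl`, line kernel-arithmetic-selection, lead c14)

Crux WORKFILE (not a Theorems file; nothing here is registered or landed).  The obstruction note
`Lines/kernel_arithmetic_selection_S7b_obstruction.md` §5(ii) states the corrected research core FCS⁺ ("free coset-line sparsity modulo dead
directions") of S7b only as Lean-shaped TEXT; this file makes it a type-checked `Prop` so that 14744's planners / a refuter / a future worker wave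
have the exact statement, and records (docstring of `FCSplus`) lead c14's paper verification of the reduction S7b ⟸ FCS⁺.

NOTHING in this file is claimed provable now: `FCSplus` is expected TRUE (it is the `k`-dimensional density form of the landed `k = 1` theorem
`stub_cosetLine_densityZero_corankOne`, p143617) and is of Zilber–Pink type for the exponential graph (growth control of the hits + o-minimal
counting + Ax–Lindemann); no proof strategy with formalised tools is known for `k ≥ 2`.
-/

noncomputable section

set_option linter.dupNamespace false

open Complex Set

namespace Summit.Schanuel.Schanuel.Cruxes.MinimalCounterexampleInAcl.KernelArithmeticSelection

open Literature.NumberTheory.Transcendental (IsZariskiClosed zariskiDim)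

/-- A set of integers has POSITIVE UPPER BANACH DENSITY: some `δ > 0` is beaten by the relative count in arbitrarily long windows
(the form used in the obstruction note §5(ii); windows `[a, a + N)`). [folklore] -/
def PosUpperBanachDensity (J : Set ℤ) : Prop :=
  ∃ δ : ℝ, 0 < δ ∧ ∀ N₀ : ℕ, ∃ N : ℕ, N₀ ≤ N ∧ ∃ a : ℤ,
    δ * (N : ℝ) ≤ (Set.ncard {j : ℤ | j ∈ Finset.Ico a (a + (N : ℤ)) ∧ j ∈ J} : ℝ)

/-- A set of integers has UPPER BANACH DENSITY ZERO. [folklore] -/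
def UpperBanachDensityZero (J : Set ℤ) : Prop :=
  ∀ δ : ℝ, 0 < δ → ∃ N₀ : ℕ, ∀ N : ℕ, N₀ ≤ N → ∀ a : ℤ,
    (Set.ncard {j : ℤ | j ∈ Finset.Ico a (a + (N : ℤ)) ∧ j ∈ J} : ℝ) < δ * (N : ℝ)

/-- **FCS⁺ — FREE COSET-LINE SPARSITY MODULO DEAD DIRECTIONS** (obstruction note §5(ii), type-checked).  Let `W ⊆ ℂ^{k+1} × ℂ^{k+1}` be
Zariski closed, `Λ ≤ ℤ^{k+1}` a lattice of "dead" directions with `dim W + rank Λ < k + 1`, and `q : ℤ → ℂ^{k+1}` a family of ℚ-linearly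
independent exponential points of `W` over the coset `c + 2πiℤ` in the `0`-th coordinate, indexed by `J ⊆ ℤ`, meeting every exponential fibre
finitely, with every dead direction constant along `J`, and FREE MODULO `Λ` ALONG EVERY SUB-FAMILY OF POSITIVE UPPER BANACH DENSITY (every
integer direction that is not rationally in `Λ` takes infinitely many values there).  Then `J` has upper Banach density zero.

`Λ = ⊥, k = 1` is the landed P1 (`stub_cosetLine_densityZero_corankOne`, Theorems/…CosetLineDensityZero, p143617).

REDUCTION S7b ⟸ FCS⁺ (paper-verified by lead c14; ≈ 1200–1500 Lean lines, not scheduled — plan F1–F4 in the obstruction note §5(iii)).  For a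
normal-form first failure `x` (rank `n`, log block of size `r`, pure block of size `k = n − r ≥ 2`) with a full line of mates `x^{(j)}` in the
log direction `μ` (`μ_{k₀} = d ≠ 0`): constants `e_i = d x_i − μ_i x_{k₀}` (`i < r`, `i ≠ k₀`; the same for every mate on the line),
`K₀ = ℚ(e)` with `trdeg ℚ(e) = r − 1` (SchanuelRank `r` on the log block), moving coordinate `v_j = x_{k₀} + 2πijd`, slice points
`Q_j = (v_j, pure block of x^{(j)}) ∈ ℂ^{1+k}`.  Stage `s` carries `s` dead directions `M¹…Mˢ` (ℚ-independent), their constant values `bᵗ`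
on a positive-density `J_s`, `K_s = K₀(b, e^b)`, and `W_s :=` the `K_s`-locus of `(Q_{j₀}, e^{Q_{j₀}})` for any `j₀ ∈ J_s`.  CHECKED:
(a) MEMBERSHIP `(Q_j, e^{Q_j}) ∈ W_s` for all `j ∈ J_s` needs only the ONE inclusion "a mate satisfies every ℚ-relation of `x`"
(`locusMates ⊆ locusPts`): a `K_s`-relation of `Q_{j₀}` becomes, after clearing denominators and substituting `b = M·Q`, `e^b = (e^Q)^M`,
`e = d x − μ x_{k₀}`, a ℚ-relation of `(x^{(j₀)}, e^{x^{(j₀)}})`, hence of `x`, hence of every `x^{(j)}`, and unwinds at `j ∈ J_s` because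
`bᵗ = Mᵗ·Q_j` there; no equality of ideals / genericity is used.  (b) DIMENSION: `zariskiDim W_s ≤ trdeg_{K_s} K_s(Q, e^Q)`
(`zariskiDim_kLocus_le`, landed) `= trdeg_{K₀}(Q, e^Q) − trdeg_{K₀}(b, e^b) = k − τ_s` (as `b, e^b ∈ ℚ(Q, e^Q)`), and `τ_s ≥ s` by
SchanuelRank `r − 1 + s ≤ n − 1` on the ℚ-independent tuple `(e, b¹, …, bˢ)` (a rational relation would be a rational relation on the
coordinates of a mate; `e^{e}` is algebraic); so `dim W_s + rank Λ_s ≤ k < k + 1`.  (c) HYPOTHESES of FCS⁺ at stage `s`: LI of `Q_j`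
(sub-tuple of a mate), fibre-finiteness (`locusMates_cexp_fibre_finite`), dead directions constant (by construction), coset form after
reindexing `J ↦ d·J` (density scales by `1/d`).  (d) EXITS: free mod `Λ_s` ⟹ FCS⁺ ⟹ density zero, contradicting positive density of `J_s`;
not free ⟹ partition regularity of upper Banach density gives `J_{s+1} ⊆ J_s` of positive density with `M^{s+1}·Q_j ≡ b^{s+1}` ⟹ stage
`s + 1`; at `s = k` freeness is automatic (a further dead direction would make `e₀ ∈ Λ_ℚ`, i.e. `v_j` constant on an infinite set).
[cite: Kirby2010, Prop. 7.2] -/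
def FCSplus : Prop :=
  ∀ (k : ℕ) (W : Set (Fin (k + 1) ⊕ Fin (k + 1) → ℂ)) (c : ℂ) (J : Set ℤ) (q : ℤ → Fin (k + 1) → ℂ)
    (Λ : Submodule ℤ (Fin (k + 1) → ℤ)),
    IsZariskiClosed ℂ W →
    zariskiDim ℂ W + ((Module.finrank ℤ Λ : ℕ) : WithBot ℕ∞) < ((k + 1 : ℕ) : WithBot ℕ∞) →
    -- hits: independent exponential points of `W` over the coset, indexed by `J`
    (∀ j ∈ J, LinearIndependent ℚ (q j) ∧ Sum.elim (q j) (cexp ∘ q j) ∈ W ∧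
        q j 0 = c + 2 * ↑Real.pi * I * (j : ℂ)) →
    -- kernel classes: the family meets every exponential fibre finitely
    (∀ ω : Fin (k + 1) → ℂ, Set.Finite {j : ℤ | j ∈ J ∧ cexp ∘ q j = ω}) →
    -- dead directions are constant along `J`
    (∀ M ∈ Λ, ∀ j ∈ J, ∀ j' ∈ J, (∑ i, (M i : ℂ) * q j i) = ∑ i, (M i : ℂ) * q j' i) →
    -- free modulo `Λ` along every sub-family of positive upper Banach density
    (∀ J' ⊆ J, PosUpperBanachDensity J' →
      ∀ M : Fin (k + 1) → ℤ, (∀ m : ℤ, m ≠ 0 → m • M ∉ Λ) →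
        Set.Infinite ((fun j => ∑ i, (M i : ℂ) * q j i) '' J')) →
    UpperBanachDensityZero J

/-- Sanity (type-check of the instantiation the reduction uses): FCS⁺ at `Λ = ⊥` says that a fibre-finite coset family of independent
exponential points on a Zariski closed `W ⊆ ℂ^{k+1} × ℂ^{k+1}` of dimension `≤ k` that is free along positive-density sub-families has
upper Banach density zero. -/
example (h : FCSplus) (k : ℕ) (W : Set (Fin (k + 1) ⊕ Fin (k + 1) → ℂ)) (c : ℂ) (J : Set ℤ) (q : ℤ → Fin (k + 1) → ℂ)
    (hW : IsZariskiClosed ℂ W) (hdim : zariskiDim ℂ W < ((k + 1 : ℕ) : WithBot ℕ∞))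
    (hq : ∀ j ∈ J, LinearIndependent ℚ (q j) ∧ Sum.elim (q j) (cexp ∘ q j) ∈ W ∧ q j 0 = c + 2 * ↑Real.pi * I * (j : ℂ))
    (hfib : ∀ ω : Fin (k + 1) → ℂ, Set.Finite {j : ℤ | j ∈ J ∧ cexp ∘ q j = ω})
    (hfree : ∀ J' ⊆ J, PosUpperBanachDensity J' → ∀ M : Fin (k + 1) → ℤ, M ≠ 0 →
      Set.Infinite ((fun j => ∑ i, (M i : ℂ) * q j i) '' J')) :
    UpperBanachDensityZero J := by
  refine h k W c J q ⊥ hW ?_ hq hfib (fun M hM => ?_) fun J' hJ' hpos M hM => hfree J' hJ' hpos M ?_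
  · simpa using hdim
  · rw [Submodule.mem_bot] at hM
    subst hM
    intro j _ j' _
    simp
  · intro h0
    exact hM 1 one_ne_zero (by simp [h0])

end Summit.Schanuel.Schanuel.Cruxes.MinimalCounterexampleInAcl.KernelArithmeticSelection

end
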